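import Summits.NavierStokesRegularity.NavierStokesRegularity.Theses.CoriolisHead
import Summits.NavierStokesRegularity.NavierStokesRegularity.Theorems.CoriolisHeadNoCoRotatingCoreNormalForm
import Summits.NavierStokesRegularity.NavierStokesRegularity.Theorems.CoriolisHeadNoCoRotatingCoreUniformGradient
import Summits.NavierStokesRegularity.NavierStokesRegularity.Theorems.CoriolisHeadNoCoRotatingCoreStrainThreshold
import HarnessLib

/-!
# Route CoriolisHead · crux `NoCoRotatingCore` (stmt-NavierStokesRegularity-22676) —
# SMALL-AMPLITUDE LIOUVILLE for bounded rotated profiles at EVERY rotation rate (a decided regime)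

Support file (`--supports stmt-NavierStokesRegularity-22676`; theorems only, no definitions, no named
facts).  The crux is equivalent to bounded rotated-profile Liouville `X`
(`noCoRotatingCore_iff_rotatedProfileLiouville`; Pineau–Vicol 2026, Conj. 1.1, in the stronger bounded,
all-rotation-rates form).  Print decides `X` only for DECAYING profiles at EXTREME rotation rates
(Pineau–Vicol Thm 1.4, `|α| ≪ 1` or `|α| ≫ 1`; tree rung `noCoRotatingCore_of_pvAnsatz_extreme_rotation`).
This file decides it in the complementary corner — SMALL AMPLITUDE, EVERY rotation rate, NO decay:

* `exists_norm_fderiv_le_of_rotatedProfile` — UNIFORM GRADIENT BOUND in the crux's variables: an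
  absolute `C` with `sup ‖DU‖ ≤ C (sup |U|)²/ν` for every smooth bounded solution of the rotated Leray
  profile system with ANY `ν, a > 0` and ANY skew `B` (normal form `CoriolisHeadNoCoRotatingCoreNormalForm`
  + the scale-invariant KNSS bound `CoriolisHeadNoCoRotatingCoreUniformGradient`; the rate `a` cancels).
* `exists_eps_rotatedProfile_const_of_small_amplitude` — **SMALL-AMPLITUDE LIOUVILLE**: an absolute
  `ε > 0` such that every smooth bounded rotated Leray profile with `(sup |U|)² < ε · aν` is CONSTANT,
  whatever the skew frame rate `B`: the gradient bound makes the vortex stretching sub-threshold,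
  `⟪ω, DU ω⟫ ≤ (C sup|U|²/ν)|ω|² < 2a|ω|²`, and the line's enstrophy max-principle threshold
  (`rotatedProfile_const_of_strain_lt`, file `CoriolisHeadNoCoRotatingCoreStrainThreshold`) concludes.
* `noCoRotatingCore_of_small_amplitude` — the RUNG: the binders of `CoriolisHead.NoCoRotatingCore`
  verbatim plus `(sup |U|)² < ε · aν` give the crux's conclusion `0 ≤ Σₗ (B ∂ₗU)ₗ` (indeed `DU ≡ 0`).
* `pvProfile_const_of_small_amplitude`, `pvProfile_eq_zero_of_small_typeI` — the same in
  Pineau–Vicol's normalisation (`ν = 1`, `a = ½`, `B = αJ`): a smooth solution of (1.8) with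
  `sup |U| < ε₁` is constant, for EVERY `α`; with the Type-I profile bound (1.9)
  `|U(y)| ≤ C_{U,0}/(1 + |y|)` and `C_{U,0} < ε₁` it vanishes — Conjecture 1.1 for small Type-I
  constant at all rotation rates including `α ≈ 1` (for decaying MILD data this is folklore
  ε-regularity; the bounded, pressure-free class treated here contains the parasitic constants
  `U ≡ b`, which is why the conclusion is "constant" and the mechanism is a gradient bound rather
  than a fixed-point argument).

HONEST FRAMING.  A decided regime, not the crux: `NoCoRotatingCore` / `X` for profiles of LARGE
amplitude (`sup|U|² ≳ aν`) at rotation rates `α ≈ 1` remains exactly Pineau–Vicol's open problem, and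
Navier–Stokes regularity is NOT proved by this file (the route also carries the open residuals
`ExtremalSpiralSymmetry`, `NoTypeII`).  The constant `ε` is not made explicit (it is `2/(C+1)` with
`C` the KNSS window constant of `KNSS2009_regularity_boundedWeak_window`).

References: B. Pineau, V. Vicol, arXiv:2607.09619 (2026), Conj. 1.1, Thm 1.4, (1.7)–(1.10)
[PineauVicol2026]; G. Koch, N. Nadirashvili, G. Seregin, V. Šverák, Acta Math. 203 (2009) =
arXiv:0709.3599, §4 (4.10) [KochNadirashviliSereginSverak2009]; T.-P. Tsai, ARMA 143 (1998), Lemma 5.1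
[Tsai1998].
-/

noncomputable section

-- the summit and its single sub-problem share the name (CONVENTIONS §1), as in every Theorems file
set_option linter.dupNamespace false

open Set Function
open scoped ContDiff Laplacian RealInnerProductSpace BigOperators
open Literature.Analysis.FluidPDE
open Summit.NavierStokesRegularity.NavierStokesRegularity.Theses

namespace Summit.NavierStokesRegularity.NavierStokesRegularity.Theorems.CoriolisHead

/-! ### Uniform gradient bound in the crux's variables -/

/-- **Uniform gradient bound for bounded rotated Leray profiles (any `ν, a > 0`, any skew `B`).**
There is an absolute constant `C ≥ 0` such that every smooth divergence-free solution `(U, P)` of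
`−νΔU + aU + a DU[y] + (BU − DU[By]) + DU[U] + ∇P = 0` with `sup |U| ≤ M` satisfies
`‖DU(y)‖ ≤ C M²/ν` at every point (normal form + the scale-invariant KNSS bound for the Pineau–Vicol
profile: `‖DU(y)‖ ≤ 2a ‖DV(z)‖ ≤ 2a · C (M/√(2aν))² = C M²/ν`).
[cite: KochNadirashviliSereginSverak2009, §4 (4.10) (arXiv:0709.3599 p. 8)] -/
theorem exists_norm_fderiv_le_of_rotatedProfile :
    ∃ C : ℝ, 0 ≤ C ∧ ∀ (ν a : ℝ), 0 < ν → 0 < a →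
      ∀ (B : EuclideanSpace ℝ (Fin 3) →L[ℝ] EuclideanSpace ℝ (Fin 3))
        (U : EuclideanSpace ℝ (Fin 3) → EuclideanSpace ℝ (Fin 3)) (P : EuclideanSpace ℝ (Fin 3) → ℝ),
        ContDiff ℝ ∞ U → ContDiff ℝ 1 P → (∀ x, ⟪B x, x⟫ = 0) → VectorCalculus.IsDivFree U →
        (∀ y, -(ν • (Δ U) y) + a • U y + a • fderiv ℝ U y y + (B (U y) - fderiv ℝ U y (B y))
          + convect U U y + gradient P y = 0) →
        ∀ {M : ℝ}, (∀ y, ‖U y‖ ≤ M) → ∀ y, ‖fderiv ℝ U y‖ ≤ C * M ^ 2 / ν := by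
  obtain ⟨C, hC, h⟩ := exists_norm_fderiv_le_of_pvProfile
  refine ⟨C, hC, ?_⟩
  intro ν a hν ha B U P hU hP hB hdiv heq M hM y
  obtain ⟨α, V, Q, hV, hQ, hdivV, heqV, hamp, hgrad⟩ :=
    exists_pvProfile_of_rotatedProfile hν ha hU hP hB hdiv heq
  obtain ⟨z, hz⟩ := hgrad y
  have hDV : ‖fderiv ℝ V z‖ ≤ C * (M / Real.sqrt (2 * a * ν)) ^ 2 := h hV hQ hdivV heqV (hamp M hM) z
  have h2 : (0 : ℝ) < 2 * a * ν := by positivity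
  calc ‖fderiv ℝ U y‖ ≤ 2 * a * ‖fderiv ℝ V z‖ := hz
    _ ≤ 2 * a * (C * (M / Real.sqrt (2 * a * ν)) ^ 2) := by gcongr
    _ = C * M ^ 2 / ν := by
        rw [div_pow, Real.sq_sqrt h2.le]
        field_simp

/-! ### Small-amplitude Liouville at every rotation rate -/

/-- **Small-amplitude Liouville for bounded rotated Leray profiles, every rotation rate.** There is
an absolute constant `ε > 0` such that: for all `ν, a > 0`, every skew `B`, and every smooth bounded
divergence-free solution `(U, P)` of the rotated Leray profile system
`−νΔU + aU + a DU[y] + (BU − DU[By]) + DU[U] + ∇P = 0` with `sup |U| ≤ M` and `M² < ε · aν`, the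
profile `U` is constant.  Mechanism: by the uniform gradient bound the vortex stretching is
sub-threshold, `⟪v, DU(y) v⟫ ≤ (C M²/ν)|v|²` with `C M²/ν < 2a`, and the enstrophy threshold
Liouville theorem `rotatedProfile_const_of_strain_lt` (max principle for `|curl U|²`, any skew frame)
applies.  (`ε = 2/(C + 1)`.) [cite: PineauVicol2026, Conjecture 1.1 (arXiv:2607.09619 p. 3)] -/
theorem exists_eps_rotatedProfile_const_of_small_amplitude :
    ∃ ε : ℝ, 0 < ε ∧ ∀ (ν a : ℝ), 0 < ν → 0 < a →
      ∀ (B : EuclideanSpace ℝ (Fin 3) →L[ℝ] EuclideanSpace ℝ (Fin 3))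
        (U : EuclideanSpace ℝ (Fin 3) → EuclideanSpace ℝ (Fin 3)) (P : EuclideanSpace ℝ (Fin 3) → ℝ),
        ContDiff ℝ (⊤ : ℕ∞) U → ContDiff ℝ 2 P → (∀ x, inner ℝ (B x) x = 0) →
        Literature.Analysis.FluidPDE.VectorCalculus.IsDivFree U →
        (∀ y, -(ν • Laplacian.laplacian U y) + a • U y + a • fderiv ℝ U y y + (B (U y) - fderiv ℝ U y (B y))
          + Literature.Analysis.FluidPDE.convect U U y + gradient P y = 0) →
        ∀ (M : ℝ), (∀ y, ‖U y‖ ≤ M) → M ^ 2 < ε * (a * ν) →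
        ∃ b : EuclideanSpace ℝ (Fin 3), ∀ y, U y = b := by
  obtain ⟨C, hC, h⟩ := exists_norm_fderiv_le_of_rotatedProfile
  refine ⟨2 / (C + 1), by positivity, ?_⟩
  intro ν a hν ha B U P hU hP hB hdiv heq M hM hsmall
  have hK : ∀ y, ‖fderiv ℝ U y‖ ≤ C * M ^ 2 / ν :=
    h ν a hν ha B U P hU (hP.of_le (by norm_num)) hB hdiv heq hM
  -- the threshold: `C M² / ν < 2a`
  have hMa : M ^ 2 * (C + 1) < 2 * (a * ν) := by
    have h1 : M ^ 2 < 2 / (C + 1) * (a * ν) := hsmall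
    rw [div_mul_eq_mul_div, lt_div_iff₀ (by positivity)] at h1
    linarith
  have hlam : C * M ^ 2 / ν < 2 * a := by
    rw [div_lt_iff₀ hν]
    nlinarith [sq_nonneg M]
  refine rotatedProfile_const_of_strain_lt ν a hν ha B U P hU hP hB hdiv heq ⟨M, hM⟩ hlam
    fun y v => ?_
  have hv : ‖fderiv ℝ U y v‖ ≤ C * M ^ 2 / ν * ‖v‖ :=
    (ContinuousLinearMap.le_opNorm _ _).trans (mul_le_mul_of_nonneg_right (hK y) (norm_nonneg _))
  calc ⟪v, fderiv ℝ U y v⟫ ≤ ‖v‖ * ‖fderiv ℝ U y v‖ := real_inner_le_norm _ _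
    _ ≤ ‖v‖ * (C * M ^ 2 / ν * ‖v‖) := mul_le_mul_of_nonneg_left hv (norm_nonneg _)
    _ = C * M ^ 2 / ν * ‖v‖ ^ 2 := by ring

/-- **RUNG of `NoCoRotatingCore` (bc5 witness with mechanism): no co-rotating core — indeed no
gradient at all — for rotated profiles of small amplitude, at EVERY rotation rate.**  There is an
absolute `ε > 0` such that the binders of `CoriolisHead.NoCoRotatingCore` (any `ν, a > 0`, any skew
`B`, a smooth bounded divergence-free solution `(U, P)` of the rotated Leray profile system) together
with the amplitude bound `sup |U| ≤ M`, `M² < ε · aν` imply the crux's conclusion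
`0 ≤ Σₗ (B ∂ₗU(y))ₗ` at every point (the profile is constant by
`exists_eps_rotatedProfile_const_of_small_amplitude`, so every defect term vanishes).  The crux for
large amplitudes at `α ≈ 1` remains open. [cite: PineauVicol2026, Conjecture 1.1 (arXiv:2607.09619 p. 3)] -/
theorem noCoRotatingCore_of_small_amplitude :
    ∃ ε : ℝ, 0 < ε ∧ ∀ (ν a : ℝ), 0 < ν → 0 < a →
      ∀ (B : EuclideanSpace ℝ (Fin 3) →L[ℝ] EuclideanSpace ℝ (Fin 3))
        (U : EuclideanSpace ℝ (Fin 3) → EuclideanSpace ℝ (Fin 3)) (P : EuclideanSpace ℝ (Fin 3) → ℝ),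
        ContDiff ℝ (⊤ : ℕ∞) U → ContDiff ℝ 2 P → (∀ x, inner ℝ (B x) x = 0) →
        Literature.Analysis.FluidPDE.VectorCalculus.IsDivFree U →
        (∀ y, -(ν • Laplacian.laplacian U y) + a • U y + a • fderiv ℝ U y y + (B (U y) - fderiv ℝ U y (B y))
          + Literature.Analysis.FluidPDE.convect U U y + gradient P y = 0) →
        (∃ M : ℝ, ∀ y, ‖U y‖ ≤ M) →
        ∀ (M : ℝ), (∀ y, ‖U y‖ ≤ M) → M ^ 2 < ε * (a * ν) →
        ∀ y, 0 ≤ ∑ l, (B (fderiv ℝ U y (EuclideanSpace.single l 1))) l := by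
  obtain ⟨ε, hε, h⟩ := exists_eps_rotatedProfile_const_of_small_amplitude
  refine ⟨ε, hε, ?_⟩
  intro ν a hν ha B U P hU hP hB hdiv heq _hbdd M hM hsmall y
  obtain ⟨b, hb⟩ := h ν a hν ha B U P hU hP hB hdiv heq M hM hsmall
  have hUc : U = fun _ => b := funext hb
  have hD : fderiv ℝ U y = 0 := by
    rw [hUc]
    exact fderiv_const_apply b
  simp [hD]

/-! ### The same in Pineau–Vicol's normalisation -/

/-- The rotation generator `J = e₃ × ·` is skew: `⟪J x, x⟫ = 0`. [folklore] -/
theorem inner_rotGenL_self (x : EuclideanSpace ℝ (Fin 3)) : ⟪rotGenL x, x⟫ = 0 := by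
  rw [rotGenL_apply, EuclideanSpace.inner_eq_star_dotProduct]
  simp [Fin.sum_univ_three, rotGen, dotProduct]
  ring

/-- **Small-amplitude Liouville in Pineau–Vicol's normalisation, every rotation rate.** There is an
absolute `ε₁ > 0` such that every smooth divergence-free solution `(U, P)` of Pineau–Vicol's rotated
profile system (1.8) `α(JU − DU[Jy]) + ½U + ½DU[y] − ΔU + DU[U] + ∇P = 0`, for ANY `α ∈ ℝ`, with
`sup |U| ≤ M < ε₁` is CONSTANT.  (The system is the crux's with `ν = 1`, `a = ½`, `B = αJ`; the
nonzero constants are the profiles of the parasitic solutions `u = R(αs)b/√(−t)`.)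
[cite: PineauVicol2026, (1.8) and Conjecture 1.1 (arXiv:2607.09619 p. 3)] -/
theorem pvProfile_const_of_small_amplitude :
    ∃ ε₁ : ℝ, 0 < ε₁ ∧ ∀ (α : ℝ) (U : EuclideanSpace ℝ (Fin 3) → EuclideanSpace ℝ (Fin 3))
      (P : EuclideanSpace ℝ (Fin 3) → ℝ), ContDiff ℝ ∞ U → ContDiff ℝ 2 P → VectorCalculus.IsDivFree U →
      (∀ y, α • (rotGen (U y) - fderiv ℝ U y (rotGen y)) + (1 / 2 : ℝ) • U y
        + (1 / 2 : ℝ) • fderiv ℝ U y y - (Δ U) y + fderiv ℝ U y (U y) + gradient P y = 0) →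
      ∀ (M : ℝ), (∀ y, ‖U y‖ ≤ M) → M < ε₁ → ∃ b : EuclideanSpace ℝ (Fin 3), ∀ y, U y = b := by
  obtain ⟨ε, hε, h⟩ := exists_eps_rotatedProfile_const_of_small_amplitude
  -- `ε₁ = min (1/2) (ε/2)`: then `M < ε₁` gives `M² < ε/4 < ε · (½ · 1)`
  refine ⟨min (1 / 2) (ε / 2), lt_min (by norm_num) (by positivity), ?_⟩
  intro α U P hU hP hdiv heq M hM hMε
  have hM0 : 0 ≤ M := (norm_nonneg _).trans (hM 0)
  have hM1 : M < 1 / 2 := hMε.trans_le (min_le_left _ _)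
  have hM2 : M < ε / 2 := hMε.trans_le (min_le_right _ _)
  have hsmall : M ^ 2 < ε * ((1 / 2 : ℝ) * 1) := by nlinarith
  -- the crux's system with `ν = 1`, `a = ½`, `B = αJ`
  have hB : ∀ x, inner ℝ ((α • rotGenL) x) x = 0 := fun x => by
    rw [smul_apply, real_inner_smul_left, inner_rotGenL_self, mul_zero]
  have heq' : ∀ y, -((1 : ℝ) • Laplacian.laplacian U y) + (1 / 2 : ℝ) • U y
      + (1 / 2 : ℝ) • fderiv ℝ U y y + ((α • rotGenL) (U y) - fderiv ℝ U y ((α • rotGenL) y))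
      + convect U U y + gradient P y = 0 := by
    intro y
    have key := heq y
    simp only [smul_apply, rotGenL_apply, ContinuousLinearMap.map_smul, convect_apply, one_smul]
    rw [← key, smul_sub]
    abel
  exact h 1 (1 / 2) one_pos (by norm_num) (α • rotGenL) U P hU hP hB hdiv heq' M hM hsmall

/-- **Pineau–Vicol's Conjecture 1.1 for small Type-I constant, at EVERY rotation rate.** There is an
absolute `ε₁ > 0` such that every smooth divergence-free solution `(U, P)` of the rotated profile
system (1.8), for ANY `α`, with the Type-I profile bound (1.9) `‖U(y)‖ ≤ K/(‖y‖ + 1)` and `K < ε₁`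
vanishes identically: it is constant by `pvProfile_const_of_small_amplitude`, and a decaying constant
is `0` (read the decay at `y = (K/‖b‖²) b`).  Print has Conj. 1.1 for every `K` but only at extreme
`|α|` (Thm 1.4); the case `α ≈ 1`, `K` large stays open. [cite: PineauVicol2026, Conjecture 1.1 and Theorem 1.4 (arXiv:2607.09619 pp. 3–4)] -/
theorem pvProfile_eq_zero_of_small_typeI :
    ∃ ε₁ : ℝ, 0 < ε₁ ∧ ∀ (α : ℝ) (U : EuclideanSpace ℝ (Fin 3) → EuclideanSpace ℝ (Fin 3))
      (P : EuclideanSpace ℝ (Fin 3) → ℝ), ContDiff ℝ ∞ U → ContDiff ℝ 2 P → VectorCalculus.IsDivFree U →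
      (∀ y, α • (rotGen (U y) - fderiv ℝ U y (rotGen y)) + (1 / 2 : ℝ) • U y
        + (1 / 2 : ℝ) • fderiv ℝ U y y - (Δ U) y + fderiv ℝ U y (U y) + gradient P y = 0) →
      ∀ (K : ℝ), (∀ y, ‖U y‖ ≤ K / (‖y‖ + 1)) → K < ε₁ → U = 0 := by
  obtain ⟨ε₁, hε₁, h⟩ := pvProfile_const_of_small_amplitude
  refine ⟨ε₁, hε₁, ?_⟩
  intro α U P hU hP hdiv heq K hK hKε
  have hK0 : 0 ≤ K := by
    have h0 := hK 0
    rw [norm_zero, zero_add, div_one] at h0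
    exact (norm_nonneg _).trans h0
  -- a decaying profile is bounded by `K`
  have hbdd : ∀ y, ‖U y‖ ≤ K := fun y => (hK y).trans (div_le_self hK0 (by
    have := norm_nonneg y; linarith))
  obtain ⟨b, hb⟩ := h α U P hU hP hdiv heq K hbdd hKε
  -- the constant value inherits the decay, hence vanishes
  have hb0 : b = 0 := by
    by_contra hne
    have hpos : 0 < ‖b‖ := norm_pos_iff.2 hne
    have h1 := hK ((K / ‖b‖ ^ 2) • b)
    rw [hb] at h1
    have hny : ‖(K / ‖b‖ ^ 2) • b‖ = K / ‖b‖ := by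
      rw [norm_smul, Real.norm_eq_abs, abs_div, abs_of_nonneg hK0, abs_of_pos (pow_pos hpos 2)]
      field_simp
    rw [hny] at h1
    have hd : 0 < K / ‖b‖ + 1 := by positivity
    have h2 : ‖b‖ * (K / ‖b‖ + 1) ≤ K := (le_div_iff₀ hd).1 h1
    have h3 : ‖b‖ * (K / ‖b‖ + 1) = K + ‖b‖ := by field_simp
    rw [h3] at h2
    linarith
  funext y
  rw [hb y, hb0, Pi.zero_apply]

end Summit.NavierStokesRegularity.NavierStokesRegularity.Theorems.CoriolisHead

end
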